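import Summits.KontsevichZagierPeriods.KontsevichZagierPeriods.Theorems.UnfoldedStokesStokesGenerationFibrewiseRungReparam
import Summits.KontsevichZagierPeriods.KontsevichZagierPeriods.Theorems.UnfoldedStokesStokesGenerationFibrewiseRungSaAngSwap
import Summits.KontsevichZagierPeriods.KontsevichZagierPeriods.Theorems.UnfoldedStokesStokesGenerationFibrewiseClosureCongr
import Literature.NumberTheory.Transcendental.SemialgebraicMapsProofs

/-!
# `StokesGeneration` (stmt-KontsevichZagierPeriods-3586) — line `fibrewise_stokes`, stub `stub_reparamKinked`

Registered stub W13k (rung 22, wave 5, lead c6) of the line `fibrewise_stokes` of the crux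
`Summit.KontsevichZagierPeriods.KontsevichZagierPeriods.Theses.UnfoldedStokes.StokesGeneration` (route UnfoldedStokes);
residual S2 = `FibStokesDecomposable` (`Theorems/UnfoldedStokesDefs.lean`). **Rule (2) for a fibrewise face-fixing
reparametrisation of one coordinate with finitely many kinks.** On the closed cube `[0,1]^N` let the integrand `f` be
`ℚ`-semialgebraic, continuous and `C¹` along the coordinate `a` (continuous fibre derivative `fₐ`), and let the new
coordinate `ψ` be `ℚ`-semialgebraic, continuous, `ψ = 0` on `{x_a = 0}`, `ψ = 1` on `{x_a = 1}`, `0 < ψ < 1` between, but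
only PIECEWISE `C¹` along `a`: differentiable with derivative `ψₐ` at the interior heights `x_a ∉ T`, `T` a finite set of
algebraic kink heights, `ψₐ` `ℚ`-semialgebraic and merely BOUNDED; everything independent of an idle coordinate `b ≠ a`.
Then the change-of-variables relator `f(x) − f(x[a ↦ ψ(x)]) · ψₐ(x)` is fibrewise-Stokes decomposable.

Proof. Verbatim the two elements of rung 13 (`fibStokesDecomposable_reparamCore`, the one-dimensional transport identity
with parameters for the straight-line homotopy `ψ_y = (1 − y) x_a + y ψ`, `y = x_b`): `G₀ = f(x[a ↦ ψ_y]) ∂ₐψ_y` along `b`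
— affine data in `y`, differentiable along every closed `b`-fibre (no kinks), bounded since `∂ₐψ_y = (1 − y) + y ψₐ` is —
and `G₁ = −f(x[a ↦ ψ_y]) (ψ − x_a)` along `a`, continuous on the cube and differentiable along `a` off the kink set
`K₁ = {x | x_a ∈ T}` (`ℚ`-semialgebraic: a finite union of coordinate hyperplanes at algebraic heights; it meets every
`a`-fibre in `⊆ T`), which is exactly what the kink clause of `FibStokesDecomposable` allows
(`fibStokesDecomposable_of_elementsK`). The carried integrands `D_j − (G_j|₁ − G_j|₀)` are `ℚ`-semialgebraic and bounded
(not continuous), hence integrable on the cube (`integrableOn_of_abs_le`); the fibre derivatives cancel identically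
(`D₀ + D₁ = 0`) and the faces of `G₀` give the relator, those of `G₁` vanish — at every point of the cube. No Jacobians, no
transcendence input, no value hypothesis; the first exercise of the kink clause for rule (2).

References: M. Kontsevich, D. Zagier, *Periods* (2001), §1.2 rules (2), (3); J. Ayoub, *Une version relative de la
conjecture des périodes de Kontsevich–Zagier*, Ann. of Math. 181 (2015), Rem. 1.5; J. Bochnak, M. Coste, M.-F. Roy,
*Real Algebraic Geometry* (1998), Prop. 2.2.6.
-/

noncomputable section

-- `Summit.KontsevichZagierPeriods.KontsevichZagierPeriods.…` is the tree's mandated layout (single-conjunct summit).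
set_option linter.dupNamespace false

namespace Summit.KontsevichZagierPeriods.KontsevichZagierPeriods.Cruxes.StokesGeneration.FibrewiseStokes

open MeasureTheory Set
open Literature.NumberTheory.Transcendental
open Literature.NumberTheory.Transcendental.KZ
open Literature.ModelTheory.ExponentialFields (IsSemialgebraic)

/-- **Registered stub `stub_reparamKinked` (W13k, rung 22): rule (2) for a fibrewise reparametrisation with finitely many
kinks (core form with an idle coordinate).** As rung 13 (`fibStokesDecomposable_reparamCore`) but the new coordinate `ψ`
is only PIECEWISE `C¹` along `a`: continuous on the closed cube, differentiable along `a` with derivative `ψₐ` at every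
interior point whose height `x_a` avoids a finite set `T` of algebraic kink heights, `ψₐ` `ℚ`-semialgebraic and BOUNDED
(not necessarily continuous). The same two elements work, now with the kink set `K = {x | x_a ∈ T}` (finite `a`-fibres)
for the element along `a`, and bounded semialgebraic (hence integrable) carried integrands — the first use of the kink
clause of `FibStokesDecomposable`. [cite: KontsevichZagier2001, §1.2 rules (2), (3)] -/
theorem stub_reparamKinked {N : ℕ} (a b : Fin N) (hab : a ≠ b) (T : Finset ℝ) (hT : ∀ t ∈ T, IsAlgebraic ℚ t)
    (f fₐ ψ ψₐ : (Fin N → ℝ) → ℝ)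
    (hf : IsSemialgebraicFunOn ℚ (Set.pi Set.univ (fun _ : Fin N => Set.Icc (0:ℝ) 1)) f)
    (hfₐ : IsSemialgebraicFunOn ℚ (Set.pi Set.univ (fun _ : Fin N => Set.Icc (0:ℝ) 1)) fₐ)
    (hψ : IsSemialgebraicFunOn ℚ (Set.pi Set.univ (fun _ : Fin N => Set.Icc (0:ℝ) 1)) ψ)
    (hψₐ : IsSemialgebraicFunOn ℚ (Set.pi Set.univ (fun _ : Fin N => Set.Icc (0:ℝ) 1)) ψₐ)
    (hfc : ContinuousOn f (Set.pi Set.univ (fun _ : Fin N => Set.Icc (0:ℝ) 1)))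
    (hfₐc : ContinuousOn fₐ (Set.pi Set.univ (fun _ : Fin N => Set.Icc (0:ℝ) 1)))
    (hψc : ContinuousOn ψ (Set.pi Set.univ (fun _ : Fin N => Set.Icc (0:ℝ) 1)))
    (hψₐB : ∃ B : ℝ, ∀ x ∈ Set.pi Set.univ (fun _ : Fin N => Set.Icc (0:ℝ) 1), |ψₐ x| ≤ B)
    (hfb : ∀ x s, f (Function.update x b s) = f x)
    (hψb : ∀ x s, ψ (Function.update x b s) = ψ x) (hψₐb : ∀ x s, ψₐ (Function.update x b s) = ψₐ x)
    (hfd : ∀ x ∈ Set.pi Set.univ (fun _ : Fin N => Set.Icc (0:ℝ) 1), x a ∈ Set.Ioo (0:ℝ) 1 →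
      HasDerivAt (fun s => f (Function.update x a s)) (fₐ x) (x a))
    (hψd : ∀ x ∈ Set.pi Set.univ (fun _ : Fin N => Set.Icc (0:ℝ) 1), x a ∈ Set.Ioo (0:ℝ) 1 → x a ∉ T →
      HasDerivAt (fun s => ψ (Function.update x a s)) (ψₐ x) (x a))
    (hψ0 : ∀ x ∈ Set.pi Set.univ (fun _ : Fin N => Set.Icc (0:ℝ) 1), x a = 0 → ψ x = 0)
    (hψ1 : ∀ x ∈ Set.pi Set.univ (fun _ : Fin N => Set.Icc (0:ℝ) 1), x a = 1 → ψ x = 1)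
    (hψIoo : ∀ x ∈ Set.pi Set.univ (fun _ : Fin N => Set.Icc (0:ℝ) 1), x a ∈ Set.Ioo (0:ℝ) 1 →
      ψ x ∈ Set.Ioo (0:ℝ) 1) :
    FibStokesDecomposable N (fun x => f x - f (Function.update x a (ψ x)) * ψₐ x) := by
  classical
  set S : Set (Fin N → ℝ) := Set.pi Set.univ (fun _ : Fin N => Set.Icc (0:ℝ) 1) with hS
  have hSsa : IsSemialgebraic ℚ S := by rw [hS, ← cube_eq_pi]; exact isSemialgebraic_cube
  have hSc : IsCompact S := isCompact_univ_pi fun _ => isCompact_Icc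
  have hmem : ∀ x ∈ S, ∀ i, x i ∈ Set.Icc (0:ℝ) 1 := fun x hx i => (Set.mem_univ_pi.mp hx) i
  have hupd : ∀ x ∈ S, ∀ (i : Fin N), ∀ s ∈ Set.Icc (0:ℝ) 1, Function.update x i s ∈ S :=
    fun x hx i s hs => update_mem_cubePi hx i hs
  have hba : b ≠ a := fun h' => hab h'.symm
  have h0I : (0:ℝ) ∈ Set.Icc (0:ℝ) 1 := ⟨le_rfl, zero_le_one⟩
  have h1I : (1:ℝ) ∈ Set.Icc (0:ℝ) 1 := ⟨zero_le_one, le_rfl⟩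
  -- `ψ` takes values in `[0,1]`
  have hψI : ∀ x ∈ S, ψ x ∈ Set.Icc (0:ℝ) 1 := by
    intro x hx
    rcases (hmem x hx a).1.eq_or_lt with h0 | hpos
    · rw [hψ0 x hx h0.symm]; exact h0I
    rcases (hmem x hx a).2.eq_or_lt with h1 | hlt1
    · rw [hψ1 x hx h1]; exact h1I
    · exact Set.Ioo_subset_Icc_self (hψIoo x hx ⟨hpos, hlt1⟩)
  -- the fibre derivative of `f` at an arbitrary interior height
  have hHf : ∀ x ∈ S, ∀ u₀ ∈ Set.Ioo (0:ℝ) 1,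
      HasDerivAt (fun u => f (Function.update x a u)) (fₐ (Function.update x a u₀)) u₀ := by
    intro x hx u₀ hu₀
    have := hfd _ (hupd x hx a u₀ (Set.Ioo_subset_Icc_self hu₀)) (by simpa using hu₀)
    simpa [Function.update_idem] using this
  -- the homotopy `u = (1 - x_b) x_a + x_b ψ`, its `a`-derivative `w` (off the kinks), the moved point `P x = x[a ↦ u x]`
  obtain ⟨u, hu⟩ : ∃ u : (Fin N → ℝ) → ℝ, u = fun x => (1 - x b) * x a + x b * ψ x := ⟨_, rfl⟩
  obtain ⟨w, hw⟩ : ∃ w : (Fin N → ℝ) → ℝ, w = fun x => (1 - x b) + x b * ψₐ x := ⟨_, rfl⟩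
  have huI : ∀ x ∈ S, u x ∈ Set.Icc (0:ℝ) 1 := by
    intro x hx
    have hxa := hmem x hx a; have hxb := hmem x hx b; have hψx := hψI x hx
    rw [hu]
    have h1 : 0 ≤ (1 - x b) * x a := mul_nonneg (sub_nonneg.2 hxb.2) hxa.1
    have h2 : 0 ≤ x b * ψ x := mul_nonneg hxb.1 hψx.1
    have h3 : (1 - x b) * x a ≤ 1 - x b := mul_le_of_le_one_right (sub_nonneg.2 hxb.2) hxa.2
    have h4 : x b * ψ x ≤ x b := mul_le_of_le_one_right hxb.1 hψx.2
    exact ⟨by linarith, by linarith⟩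
  have huIoo : ∀ x ∈ S, x a ∈ Set.Ioo (0:ℝ) 1 → u x ∈ Set.Ioo (0:ℝ) 1 := by
    intro x hx hxa
    have hxb := hmem x hx b; have hψx := hψIoo x hx hxa
    rw [hu]
    have hm : 0 < min (x a) (ψ x) := lt_min hxa.1 hψx.1
    have hM : max (x a) (ψ x) < 1 := max_lt hxa.2 hψx.2
    have h1 : 0 ≤ (1 - x b) * (x a - min (x a) (ψ x)) := mul_nonneg (sub_nonneg.2 hxb.2) (sub_nonneg.2 (min_le_left _ _))
    have h2 : 0 ≤ x b * (ψ x - min (x a) (ψ x)) := mul_nonneg hxb.1 (sub_nonneg.2 (min_le_right _ _))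
    have h3 : 0 ≤ (1 - x b) * (max (x a) (ψ x) - x a) := mul_nonneg (sub_nonneg.2 hxb.2) (sub_nonneg.2 (le_max_left _ _))
    have h4 : 0 ≤ x b * (max (x a) (ψ x) - ψ x) := mul_nonneg hxb.1 (sub_nonneg.2 (le_max_right _ _))
    exact ⟨by nlinarith, by nlinarith⟩
  obtain ⟨P, hP⟩ : ∃ P : (Fin N → ℝ) → (Fin N → ℝ), P = fun x => Function.update x a (u x) := ⟨_, rfl⟩
  have hPC : ∀ x ∈ S, P x ∈ S := fun x hx => by rw [hP]; exact hupd x hx a _ (huI x hx)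
  -- semialgebraic-and-continuous resp. semialgebraic-and-bounded atoms on the compact cube
  have sb : ∀ {F : (Fin N → ℝ) → ℝ}, IsSemialgebraicFunOn ℚ S F ∧ ContinuousOn F S →
      IsSemialgebraicFunOn ℚ S F ∧ ∃ C : ℝ, ∀ x ∈ S, |F x| ≤ C := fun hF => kAngSB_of_sc hF hSc
  have sbneg : ∀ {F : (Fin N → ℝ) → ℝ}, (IsSemialgebraicFunOn ℚ S F ∧ ∃ C : ℝ, ∀ x ∈ S, |F x| ≤ C) →
      IsSemialgebraicFunOn ℚ S (fun x => -F x) ∧ ∃ C : ℝ, ∀ x ∈ S, |-F x| ≤ C :=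
    fun hF => ⟨hF.1.fun_neg, hF.2.imp fun C hC x hx => (abs_neg _).le.trans (hC x hx)⟩
  have hxa : IsSemialgebraicFunOn ℚ S (fun x => x a) ∧ ContinuousOn (fun x => x a) S := angTrSC_apply hSsa a
  have hxb : IsSemialgebraicFunOn ℚ S (fun x => x b) ∧ ContinuousOn (fun x => x b) S := angTrSC_apply hSsa b
  have h1 : IsSemialgebraicFunOn ℚ S (fun _ => (1:ℝ)) ∧ ContinuousOn (fun _ => (1:ℝ)) S :=
    angTrSC_const hSsa isAlgebraic_one
  have hψsc : IsSemialgebraicFunOn ℚ S ψ ∧ ContinuousOn ψ S := ⟨hψ, hψc⟩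
  have hψₐsb : IsSemialgebraicFunOn ℚ S ψₐ ∧ ∃ C : ℝ, ∀ x ∈ S, |ψₐ x| ≤ C := ⟨hψₐ, hψₐB⟩
  have husc : IsSemialgebraicFunOn ℚ S u ∧ ContinuousOn u S := by
    rw [hu]; exact angTrSC_add (angTrSC_mul (angTrSC_sub h1 hxb) hxa) (angTrSC_mul hxb hψsc)
  have hwsb : IsSemialgebraicFunOn ℚ S w ∧ ∃ C : ℝ, ∀ x ∈ S, |w x| ≤ C := by
    rw [hw]; exact kAngSB_add (sb (angTrSC_sub h1 hxb)) (kAngSB_mul (sb hxb) hψₐsb)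
  have hP_sa : IsSemialgebraicMapOn ℚ S P := by
    refine IsSemialgebraicMapOn.of_forall hSsa fun j => ?_
    rcases eq_or_ne j a with rfl | hja
    · exact husc.1.congr fun x _ => by simp [hP]
    · exact (isSemialgebraicFunOn_apply hSsa j).congr fun x _ => by simp [hP, Function.update_of_ne hja]
  have hP_c : ContinuousOn P S := by
    refine continuousOn_pi' fun j => ?_
    rcases eq_or_ne j a with rfl | hja
    · exact husc.2.congr fun x _ => by simp [hP]
    · exact (continuous_apply j).continuousOn.congr fun x _ => by simp [hP, Function.update_of_ne hja]
  have hfP : IsSemialgebraicFunOn ℚ S (fun x => f (P x)) ∧ ContinuousOn (fun x => f (P x)) S :=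
    ⟨IsSemialgebraicFunOn.comp_isSemialgebraicMapOn_holds hf hP_sa hPC, hfc.comp hP_c hPC⟩
  have hfₐP : IsSemialgebraicFunOn ℚ S (fun x => fₐ (P x)) ∧ ContinuousOn (fun x => fₐ (P x)) S :=
    ⟨IsSemialgebraicFunOn.comp_isSemialgebraicMapOn_holds hfₐ hP_sa hPC, hfₐc.comp hP_c hPC⟩
  -- the witnesses
  obtain ⟨G0, hG0⟩ : ∃ G0 : (Fin N → ℝ) → ℝ, G0 = fun x => f (P x) * w x := ⟨_, rfl⟩
  obtain ⟨D0, hD0⟩ : ∃ D0 : (Fin N → ℝ) → ℝ, D0 = fun x =>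
      fₐ (P x) * (ψ x - x a) * w x + f (P x) * (ψₐ x - 1) := ⟨_, rfl⟩
  obtain ⟨G1, hG1⟩ : ∃ G1 : (Fin N → ℝ) → ℝ, G1 = fun x => -(f (P x) * (ψ x - x a)) := ⟨_, rfl⟩
  obtain ⟨D1, hD1⟩ : ∃ D1 : (Fin N → ℝ) → ℝ, D1 = fun x =>
      -(fₐ (P x) * w x * (ψ x - x a) + f (P x) * (ψₐ x - 1)) := ⟨_, rfl⟩
  have hG0sb : IsSemialgebraicFunOn ℚ S G0 ∧ ∃ C : ℝ, ∀ x ∈ S, |G0 x| ≤ C := by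
    rw [hG0]; exact kAngSB_mul (sb hfP) hwsb
  have hD0sb : IsSemialgebraicFunOn ℚ S D0 ∧ ∃ C : ℝ, ∀ x ∈ S, |D0 x| ≤ C := by
    rw [hD0]
    exact kAngSB_add (kAngSB_mul (kAngSB_mul (sb hfₐP) (sb (angTrSC_sub hψsc hxa))) hwsb)
      (kAngSB_mul (sb hfP) (kAngSB_sub hψₐsb (sb h1)))
  have hG1sc : IsSemialgebraicFunOn ℚ S G1 ∧ ContinuousOn G1 S := by
    rw [hG1]
    have h := angTrSC_mul hfP (angTrSC_sub hψsc hxa)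
    exact ⟨h.1.fun_neg, h.2.neg⟩
  have hD1sb : IsSemialgebraicFunOn ℚ S D1 ∧ ∃ C : ℝ, ∀ x ∈ S, |D1 x| ≤ C := by
    rw [hD1]
    exact sbneg (kAngSB_add (kAngSB_mul (kAngSB_mul (sb hfₐP) hwsb) (sb (angTrSC_sub hψsc hxa)))
      (kAngSB_mul (sb hfP) (kAngSB_sub hψₐsb (sb h1))))
  -- faces of bounded semialgebraic functions at algebraic heights
  have hface_sb : ∀ {F : (Fin N → ℝ) → ℝ}, (IsSemialgebraicFunOn ℚ S F ∧ ∃ C : ℝ, ∀ x ∈ S, |F x| ≤ C) →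
      ∀ (i : Fin N) (t : ℝ), IsAlgebraic ℚ t → t ∈ Set.Icc (0:ℝ) 1 →
      IsSemialgebraicFunOn ℚ S (fun x => F (Function.update x i t)) ∧
        ∃ C : ℝ, ∀ x ∈ S, |F (Function.update x i t)| ≤ C :=
    fun hF i t ht htI => ⟨IsSemialgebraicFunOn.comp_isSemialgebraicMapOn_holds hF.1
      (isSemialgebraicMapOn_update_const i ht) fun x hx => hupd x hx i t htI,
      hF.2.imp fun C hC x hx => hC _ (hupd x hx i t htI)⟩
  have hcu : ∀ (x : Fin N → ℝ) (i : Fin N), Continuous fun s : ℝ => Function.update x i s :=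
    fun x i => continuous_const.update i continuous_id
  -- integrands (bounded and semialgebraic, not continuous) and the carried closed-cube representations
  obtain ⟨I0, hI0⟩ : ∃ I0 : (Fin N → ℝ) → ℝ, I0 = fun x =>
      D0 x - (G0 (Function.update x b 1) - G0 (Function.update x b 0)) := ⟨_, rfl⟩
  obtain ⟨I1, hI1⟩ : ∃ I1 : (Fin N → ℝ) → ℝ, I1 = fun x =>
      D1 x - (G1 (Function.update x a 1) - G1 (Function.update x a 0)) := ⟨_, rfl⟩
  have hI0sb : IsSemialgebraicFunOn ℚ S I0 ∧ ∃ C : ℝ, ∀ x ∈ S, |I0 x| ≤ C := by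
    rw [hI0]
    exact kAngSB_sub hD0sb (kAngSB_sub (hface_sb hG0sb b 1 isAlgebraic_one h1I)
      (hface_sb hG0sb b 0 isAlgebraic_zero h0I))
  have hI1sb : IsSemialgebraicFunOn ℚ S I1 ∧ ∃ C : ℝ, ∀ x ∈ S, |I1 x| ≤ C := by
    rw [hI1]
    exact kAngSB_sub hD1sb (kAngSB_sub (hface_sb (sb hG1sc) a 1 isAlgebraic_one h1I)
      (hface_sb (sb hG1sc) a 0 isAlgebraic_zero h0I))
  have hrep : ∀ {I : (Fin N → ℝ) → ℝ}, (IsSemialgebraicFunOn ℚ S I ∧ ∃ C : ℝ, ∀ x ∈ S, |I x| ≤ C) →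
      ∃ t : IntegralRep N, t.domain = S ∧ t.integrand = I := fun {I} hI =>
    ⟨{ domain := S
       integrand := I
       isSemialgebraic_domain := hSsa
       isSemialgebraicFunOn_integrand := hI.1
       integrableOn := hI.2.elim fun C hC => integrableOn_of_abs_le hSsa hSc.measure_lt_top.ne hI.1 hC }, rfl, rfl⟩
  obtain ⟨q0, hq0d, hq0i⟩ := hrep hI0sb
  obtain ⟨q1, hq1d, hq1i⟩ := hrep hI1sb
  -- the kink set of the element along `a`: the hyperplanes `{x_a = t}`, `t ∈ T`
  have hK1sa : IsSemialgebraic ℚ {x : Fin N → ℝ | x a ∈ (T : Set ℝ)} := by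
    convert IsSemialgebraic.biUnion T (fun c => {x : Fin N → ℝ | x a = c}) fun c hc =>
      isSemialgebraic_setOf_apply_eq_of_isAlgebraic (hT c hc) a using 1
    ext x
    simp
  -- pointwise bookkeeping along the two fibres
  have hu_b : ∀ x s, u (Function.update x b s) = (1 - s) * x a + s * ψ x := by
    intro x s; rw [hu]; simp [Function.update_of_ne hab, hψb]
  have hw_b : ∀ x s, w (Function.update x b s) = (1 - s) + s * ψₐ x := by
    intro x s; rw [hw]; simp [hψₐb]
  have hfP_b : ∀ x s, f (P (Function.update x b s)) = f (Function.update x a ((1 - s) * x a + s * ψ x)) := by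
    intro x s; rw [hP]; simp only [hu_b]; rw [Function.update_comm hba, hfb]
  have hu_a : ∀ x s, u (Function.update x a s) = (1 - x b) * s + x b * ψ (Function.update x a s) := by
    intro x s; rw [hu]; simp [Function.update_of_ne hba]
  have hP_a : ∀ x s, P (Function.update x a s) =
      Function.update x a ((1 - x b) * s + x b * ψ (Function.update x a s)) := by
    intro x s; rw [hP]; simp only [hu_a, Function.update_idem]
  -- the element along `b`: differentiable along every closed `b`-fibre (affine data in `y = x_b`, no kinks)
  have hG0der : ∀ x ∈ S, HasDerivAt (fun s : ℝ => G0 (Function.update x b s)) (D0 x) (x b) := by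
    intro x hx
    have hfun : (fun s : ℝ => G0 (Function.update x b s)) =
        fun s => f (Function.update x a ((1 - s) * x a + s * ψ x)) * ((1 - s) + s * ψₐ x) := by
      funext s; rw [hG0]; simp only [hfP_b, hw_b]
    rw [hfun, hD0]
    simp only
    have hPx : P x = Function.update x a ((1 - x b) * x a + x b * ψ x) := by rw [hP, hu]
    have hl : HasDerivAt (fun s : ℝ => (1 - s) + s * ψₐ x) (ψₐ x - 1) (x b) := by
      have := ((hasDerivAt_id' (x b)).const_sub 1).add ((hasDerivAt_id' (x b)).mul_const (ψₐ x))
      exact this.congr_deriv (by ring)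
    have hin : HasDerivAt (fun s : ℝ => (1 - s) * x a + s * ψ x) (ψ x - x a) (x b) := by
      have := (((hasDerivAt_id' (x b)).const_sub 1).mul_const (x a)).add
        ((hasDerivAt_id' (x b)).mul_const (ψ x))
      exact this.congr_deriv (by ring)
    have hwx : w x = (1 - x b) + x b * ψₐ x := by rw [hw]
    rcases (hmem x hx a).1.eq_or_lt with ha0 | hapos
    · -- `x_a = 0`: `ψ x = 0`, the moved point is frozen
      have hψ0x : ψ x = 0 := hψ0 x hx ha0.symm
      rw [hPx, hψ0x, ← ha0]
      simp only [mul_zero, add_zero, sub_zero, zero_mul, zero_add]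
      exact ((hl.const_mul (f (Function.update x a 0))).congr_deriv (by ring)).congr_of_eventuallyEq
        (Filter.Eventually.of_forall fun s => by simp)
    rcases (hmem x hx a).2.eq_or_lt with ha1 | halt1
    · -- `x_a = 1`: `ψ x = 1`
      have hψ1x : ψ x = 1 := hψ1 x hx ha1
      rw [hPx, hψ1x, ha1]
      have hfun' : (fun s : ℝ => f (Function.update x a ((1 - s) * 1 + s * 1)) * ((1 - s) + s * ψₐ x)) =
          fun s => f (Function.update x a 1) * ((1 - s) + s * ψₐ x) := by
        funext s; ring_nf
      rw [hfun']
      refine (hl.const_mul (f (Function.update x a 1))).congr_deriv ?_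
      ring_nf
    · -- interior: chain rule through the homotopy
      have hxaI : x a ∈ Set.Ioo (0:ℝ) 1 := ⟨hapos, halt1⟩
      have huxI : (1 - x b) * x a + x b * ψ x ∈ Set.Ioo (0:ℝ) 1 := by
        have := huIoo x hx hxaI; rwa [hu] at this
      have hout := hHf x hx _ huxI
      have hcomp : HasDerivAt (fun s : ℝ => f (Function.update x a ((1 - s) * x a + s * ψ x)))
          (fₐ (Function.update x a ((1 - x b) * x a + x b * ψ x)) * (ψ x - x a)) (x b) :=
        HasDerivAt.comp (x b) (h₂ := fun v => f (Function.update x a v)) hout hin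
      rw [hPx, hwx]
      exact (hcomp.mul hl).congr_deriv (by ring)
  -- assemble the two elements (kink sets `∅` and `{x_a ∈ T}`)
  have hdec : FibStokesDecomposable N (fun x => ∑ j, ((![q0, q1] : Fin 2 → IntegralRep N) j).integrand x) := by
    refine fibStokesDecomposable_of_elementsK (M := N) (J := 2) (![b, a] : Fin 2 → Fin N)
      (![G0, G1] : Fin 2 → (Fin N → ℝ) → ℝ) (![D0, D1] : Fin 2 → (Fin N → ℝ) → ℝ)
      (![∅, {x : Fin N → ℝ | x a ∈ (T : Set ℝ)}] : Fin 2 → Set (Fin N → ℝ))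
      (![q0, q1] : Fin 2 → IntegralRep N) ?_ ?_
    · refine Fin.forall_fin_two.mpr ⟨?_, ?_⟩
      · -- element 0, along `b` (the homotopy parameter): no kinks
        simp only [Matrix.cons_val_zero]
        refine ⟨hG0sb.1, hD0sb.1, Literature.ModelTheory.ExponentialFields.isSemialgebraic_empty, hG0sb.2,
          fun x _ => by simp, fun x hx => ?_, fun x hx _ _ => hG0der x hx⟩
        intro s hs
        have h := hG0der _ (hupd x hx b s hs)
        simp only [Function.update_idem, Function.update_self] at h
        exact h.continuousAt.continuousWithinAt
      · -- element 1, along `a`: kink set `{x_a ∈ T}`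
        simp only [Matrix.cons_val_one, Matrix.cons_val_zero]
        refine ⟨hG1sc.1, hD1sb.1, hK1sa, (sb hG1sc).2, fun x _ => ?_, fun x hx => ?_, fun x hx hxK hxa' => ?_⟩
        · show Set.Finite {s : ℝ | Function.update x a s ∈ {z : Fin N → ℝ | z a ∈ (T : Set ℝ)}}
          simp
        · exact hG1sc.2.comp (hcu x a).continuousOn fun s hs => hupd x hx a s hs
        · have hxaI : x a ∈ Set.Ioo (0:ℝ) 1 := by simpa using hxa'
          have hxaT : x a ∉ T := fun h =>
            hxK (show x ∈ {z : Fin N → ℝ | z a ∈ (T : Set ℝ)} from Finset.mem_coe.mpr h)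
          have hfun : (fun s : ℝ => G1 (Function.update x a s)) =
              fun s => -(f (Function.update x a ((1 - x b) * s + x b * ψ (Function.update x a s))) *
                (ψ (Function.update x a s) - s)) := by
            funext s; rw [hG1]; simp only [hP_a, Function.update_self]
          rw [hfun, hD1]
          simp only
          have hPx : P x = Function.update x a ((1 - x b) * x a + x b * ψ x) := by rw [hP, hu]
          have hwx : w x = (1 - x b) + x b * ψₐ x := by rw [hw]
          have huxI : (1 - x b) * x a + x b * ψ x ∈ Set.Ioo (0:ℝ) 1 := by
            have := huIoo x hx hxaI; rwa [hu] at this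
          -- inner map `s ↦ (1 - x_b) s + x_b ψ(x[a ↦ s])`, differentiable at `x_a ∉ T`
          have hin : HasDerivAt (fun s : ℝ => (1 - x b) * s + x b * ψ (Function.update x a s))
              ((1 - x b) + x b * ψₐ x) (x a) := by
            have := ((hasDerivAt_id' (x a)).const_mul (1 - x b)).add ((hψd x hx hxaI hxaT).const_mul (x b))
            refine (this.congr_of_eventuallyEq (Filter.Eventually.of_forall fun s => by simp)).congr_deriv ?_
            ring
          have hin0 : (fun s : ℝ => (1 - x b) * s + x b * ψ (Function.update x a s)) (x a) =
              (1 - x b) * x a + x b * ψ x := by simp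
          have hout := hHf x hx _ huxI
          rw [← hin0] at hout
          have hcomp : HasDerivAt (fun s : ℝ => f (Function.update x a ((1 - x b) * s + x b * ψ (Function.update x a s))))
              (fₐ (Function.update x a ((fun s : ℝ => (1 - x b) * s + x b * ψ (Function.update x a s)) (x a))) *
                ((1 - x b) + x b * ψₐ x)) (x a) :=
            HasDerivAt.comp (x a) (h₂ := fun v => f (Function.update x a v)) hout hin
          simp only [Function.update_eq_self] at hcomp
          have hsec : HasDerivAt (fun s : ℝ => ψ (Function.update x a s) - s) (ψₐ x - 1) (x a) :=
            (hψd x hx hxaI hxaT).sub (hasDerivAt_id' (x a))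
          rw [hPx, hwx]
          refine ((hcomp.mul hsec).neg).congr_deriv ?_
          simp only [Function.update_eq_self]
    · refine Fin.forall_fin_two.mpr ⟨?_, ?_⟩
      · simp only [Matrix.cons_val_zero]
        exact ⟨hq0d, fun x _ => by rw [hq0i, hI0]⟩
      · simp only [Matrix.cons_val_one, Matrix.cons_val_zero]
        exact ⟨hq1d, fun x _ => by rw [hq1i, hI1]⟩
  -- the pointwise identity, at every point of the cube: `D₀ + D₁ = 0`, the faces of `G₀` give the relator,
  -- those of `G₁` vanish
  refine fibStokesDecomposable_congr_off_null N _ _ ∅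
    Literature.ModelTheory.ExponentialFields.isSemialgebraic_empty measure_empty (fun x hx _ => ?_) hdec
  have hface0 : G0 (Function.update x b 1) - G0 (Function.update x b 0) =
      f (Function.update x a (ψ x)) * ψₐ x - f x := by
    rw [hG0]; simp only [hfP_b, hw_b]; simp
  have hface1 : G1 (Function.update x a 1) - G1 (Function.update x a 0) = 0 := by
    rw [hG1]
    simp only [Function.update_self, hψ1 _ (hupd x hx a 1 h1I) (by simp), hψ0 _ (hupd x hx a 0 h0I) (by simp)]
    ring
  have hsum : D0 x + D1 x = 0 := by rw [hD0, hD1]; simp only; ring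
  simp only [Fin.sum_univ_two, Matrix.cons_val_zero, Matrix.cons_val_one, hq0i, hq1i, hI0, hI1, hface0, hface1]
  linarith

end Summit.KontsevichZagierPeriods.KontsevichZagierPeriods.Cruxes.StokesGeneration.FibrewiseStokes

end
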